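import Summits.BirchSwinnertonDyer.BirchSwinnertonDyer.Theses.ThetaPartnerAtTwo
import Summits.BirchSwinnertonDyer.BirchSwinnertonDyer.Theorems.ThetaPartnerAtTwoSignedTransportAtTwoRankZeroOfPrint
import Summits.BirchSwinnertonDyer.BirchSwinnertonDyer.Theorems.ThetaPartnerAtTwoMazurTateCongruenceAtTwoTopOfPublishedInputs
import HarnessLib

/-!
# CERTIFICATE for the TP2 pen / director-bsd (lead prover bsd-wall-tp2-p1 g12): K1 CLOSE-OUT — fold the Hecke-side HOLD bundle
# `PublishedInputsHeckeAtTwo` (item 27435) into the K1 binder, the way W-75 WINDOW 5 folded K1 into K1P (25785).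
# Scratch file (evidence), NOT a tree proposal; nothing here edits the route. Own namespace `…Cruxes.MazurTateCongruenceAtTwoTop.CloseOut`
# (so the proposed decl names stay free for the route file); inside it the route namespace is `open`ed, so the texts read verbatim.

STATE OF RECORD (tree, rev 42 `ec15a34a18ea`): `closes` binds `(hMTt : MazurTateCongruenceAtTwoTop)` (crux 25797 = 21416 BY NAME) and
`(hK1P : SignedTransportAtTwoRankZeroOfPub)` (25785, CLOSED) and uses them once: `hK1P hG1 hG2 hG3 hG5 hGZK hMTt …`. The crux is a kernel
theorem GRANTED item 27435 alone: `Theorems.MazurTateCongruenceAtTwoR.mazurTateCongruenceAtTwoR_of_publishedInputsHeckeAtTwo`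
(p631563 ✓, width tp2-p1-w3 g0 over the lead lineage's μ-free Ihara road). Because every by-name closer lives in a Theorems module that
imports this route file, `closes` can never consume it (import cycle) — so 25797 stays an OPEN crux binder for ever unless the binder
list changes. Two admissible edits, both certified below (rc 0, axioms std), both LOSSLESS:

(P3, primary) K1PH := K1P with its sixth antecedent `MazurTateCongruenceAtTwoR →` replaced by `PublishedInputsHeckeAtTwo →`
  (text `SignedTransportAtTwoRankZeroOfPubHecke` below, = K1P text otherwise VERBATIM); closes binds `(hPubH : PublishedInputsHeckeAtTwo)`
  (27435, support HOLD — same posture as hPubG 24143) and `(hK1PH : …OfPubHecke)` in place of `hMTt hK1P`; body changes in ONE application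
  (`hK1PH hG1 hG2 hG3 hG5 hGZK hPubH`). One-liner closer: `signedTransportAtTwoRankZeroOfPubHecke_proof`. Then 25797 AND 21416 are named by
  no binder ⇒ both retire to aside without cone pinning; K1 rests on HOLD 27435 only; cruxes 4 → 3 (26471, 26470, 25631).
(P2, alternative) K1-OfPub twin `MazurTateCongruenceAtTwoTopOfPub := PublishedInputsHeckeAtTwo → MazurTateCongruenceAtTwoR` (support,
  closable by `mazurTateCongruenceAtTwoR_of_publishedInputsHeckeAtTwo`); closes binds `(hPubH) (hMTtP)` in place of `hMTt` and feeds
  `hK1P … (hMTtP hPubH)`; K1P untouched; 25797 → aside (21416 stays named by K1P's text).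
Se NOTE: once tp2-p1-w4 g0's p634856 (`…TopOfThreeFacts`) lands, the Serre conjunct of 27435 is idle for K1 (`…_of_esSdBzAu`); the texts
below deliberately keep the bundle BY NAME so that a later slimming of 27435 changes nothing here.
BSD is not proved by any of this; every statement below is conditional on the HOLD inputs exactly as the live closes is.
-/

set_option autoImplicit false
set_option linter.dupNamespace false

namespace Summit.BirchSwinnertonDyer.BirchSwinnertonDyer.Cruxes.MazurTateCongruenceAtTwoTop.CloseOut

open Summit.BirchSwinnertonDyer.BirchSwinnertonDyer.Theses.ThetaPartnerAtTwo

/-- PROPOSED ITEM TEXT (K1PH, pattern K1P / K2r0P / K4P): conjuncts 1, 2, 3, 5 of `PublishedInputsGreenbergControlAtTwo` → GZK fact →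
`PublishedInputsHeckeAtTwo` (item 27435, PUB⁵ HOLD bundle) → K1Ar (the text of `SignedTransportAtTwo` with `A.analyticRank = 0 →`
inserted after `A.HasCM →`). = the live text of `SignedTransportAtTwoRankZeroOfPub` (25785) with its antecedent
`MazurTateCongruenceAtTwoR →` replaced by `PublishedInputsHeckeAtTwo →`, verbatim otherwise. -/
def SignedTransportAtTwoRankZeroOfPubHecke : Prop :=
  Literature.NumberTheory.EllipticCurves.Greenberg1999.casselsSurjectivity_H1Sigma ℚ → Literature.NumberTheory.EllipticCurves.Greenberg1999.prop412_noFiniteSubmodule_H1Sigma_of_rank_one → Literature.NumberTheory.EllipticCurves.Greenberg1999.h1Sigma_zpCorank_le_degree ℚ → Literature.NumberTheory.EllipticCurves.Greenberg1999.h1SigmaInfty_rank_eq_one → Literature.NumberTheory.EllipticCurves.rank_eq_analyticRank_of_analyticRank_le_one → Summit.BirchSwinnertonDyer.BirchSwinnertonDyer.Theses.ThetaPartnerAtTwo.PublishedInputsHeckeAtTwo → ∀ (W : WeierstrassCurve ℚ) [W.IsElliptic] [W.IsGloballyMinimal] (A : WeierstrassCurve ℚ) [A.IsElliptic] [A.IsGloballyMinimal],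 ¬ W.HasCM → W.analyticRank = 0 → Literature.NumberTheory.EllipticCurves.Rank1Residual.GoodSS W 2 → W.frobeniusTrace 2 = 0 → A.HasCM → A.analyticRank = 0 → Literature.NumberTheory.EllipticCurves.Rank1Residual.GoodSS A 2 → A.frobeniusTrace 2 = 0 → (∃ e : WeierstrassCurve.geomTorsion W (2 : ℤ) ≃+ WeierstrassCurve.geomTorsion A (2 : ℤ), ∀ (σ : Field.absoluteGaloisGroup ℚ) (P : WeierstrassCurve.geomTorsion W (2 : ℤ)), e (σ • P) = σ • e P) → ∀ [NeZero (A.conductorNorm ℤ)] (fA : CuspForm (CongruenceSubgroup.Gamma0 (A.conductorNorm ℤ)) 2), Literature.NumberTheory.EllipticCurves.ModularForms.IsNewformOf A fA → ∀ (ϖA : ℚ), (ϖA : ℝ) * A.realPeriodRat = Literature.NumberTheory.EllipticCurves.ModularForms.plusPeriod fA → ∀ (LsharpA LflatA : Literature.NumberTheory.EllipticCurves.IwasawaAlgebra 2), Summit.BirchSwinnertonDyer.Rank1Residual.Supersingular.IsPollackPair fA 2 LsharpA LflatA → (∀ (κ : Literature.NumberTheory.EllipticCurves.ZpExtension ℚ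 2) (γ : Field.absoluteGaloisGroup ℚ), κ.IsCyclotomic → κ.IsTopGenerator γ → ∀ D : Literature.NumberTheory.EllipticCurves.Kobayashi2003.SignedSelmerDualData A κ γ 1, Module.IsTorsion (Literature.NumberTheory.EllipticCurves.IwasawaAlgebra 2) D.X ∧ D.mu = 0) → Summit.BirchSwinnertonDyer.Rank1Residual.Supersingular.KobayashiMainConjecture A 2 1 → (∀ (κ : Literature.NumberTheory.EllipticCurves.ZpExtension ℚ 2) (γ : Field.absoluteGaloisGroup ℚ), κ.IsCyclotomic → κ.IsTopGenerator γ → Literature.NumberTheory.EllipticCurves.IsCyclotomicVariable 2 γ → ∀ [NeZero (W.conductorNorm ℤ)] (f : CuspForm (CongruenceSubgroup.Gamma0 (W.conductorNorm ℤ)) 2), Literature.NumberTheory.EllipticCurves.ModularForms.IsNewformOf W f → ∀ (ϖ : ℚ), (ϖ : ℝ) * W.realPeriodRat = Literature.NumberTheory.EllipticCurves.ModularForms.plusPeriod f → ∀ (Lplus Lminus : Literature.NumberTheory.EllipticCurves.IwasawaAlgebra 2), Summit.BirchSwinnertonDyer.Rank1Residual.Supersingular.IsPollackPair f 2 Lplus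 Lminus → ∀ (D : Literature.NumberTheory.EllipticCurves.Kobayashi2003.SignedSelmerDualData W κ γ 1), ∃ (g h : Literature.NumberTheory.EllipticCurves.IwasawaAlgebra 2) (m : ℕ), D.charIdeal = Ideal.span {g} ∧ Literature.NumberTheory.EllipticCurves.iwasawaToPowerSeries 2 (g * h) = PowerSeries.C ((2 : ℚ_[2]) ^ m * (ϖ : ℚ_[2])) * Literature.NumberTheory.EllipticCurves.iwasawaToPowerSeries 2 (Summit.BirchSwinnertonDyer.Rank1Residual.Supersingular.kobayashiL 1 Lplus Lminus)) → Summit.BirchSwinnertonDyer.Rank1Residual.Supersingular.KobayashiMainConjecture W 2 1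

/-- K1PH is PROVED by one line over the landed K1P road (p600518) and the landed K1 closer (p631563). -/
theorem signedTransportAtTwoRankZeroOfPubHecke_proof : SignedTransportAtTwoRankZeroOfPubHecke :=
  fun hG1 hG2 hG3 hG5 hGZK hPubH =>
    Summit.BirchSwinnertonDyer.BirchSwinnertonDyer.Theorems.SignedTransportAtTwo.signedTransportAtTwo_rankZero_of_print4
      hG1 hG2 hG3 hG5 hGZK
      (Summit.BirchSwinnertonDyer.BirchSwinnertonDyer.Theorems.MazurTateCongruenceAtTwoR.mazurTateCongruenceAtTwoR_of_publishedInputsHeckeAtTwo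
        hPubH)

/-- LOSSLESS: K1PH is exactly K1P composed with «PUB⁵ ⟹ K1» — nothing any consumer had is lost. -/
theorem signedTransportAtTwoRankZeroOfPubHecke_of_k1P (hK1P : SignedTransportAtTwoRankZeroOfPub)
    (hK1 : PublishedInputsHeckeAtTwo → MazurTateCongruenceAtTwoR) : SignedTransportAtTwoRankZeroOfPubHecke :=
  fun hG1 hG2 hG3 hG5 hGZK hPubH => hK1P hG1 hG2 hG3 hG5 hGZK (hK1 hPubH)

/-- ALTERNATIVE ITEM TEXT (P2, K1-OfPub twin): the Hecke-side HOLD bundle implies the Mazur–Tate congruence at `2` (21416 BY NAME). -/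
def MazurTateCongruenceAtTwoTopOfPub : Prop :=
  PublishedInputsHeckeAtTwo → MazurTateCongruenceAtTwoR

/-- The K1-OfPub twin is PROVED by the landed closer (p631563). -/
theorem mazurTateCongruenceAtTwoTopOfPub_proof : MazurTateCongruenceAtTwoTopOfPub :=
  Summit.BirchSwinnertonDyer.BirchSwinnertonDyer.Theorems.MazurTateCongruenceAtTwoR.mazurTateCongruenceAtTwoR_of_publishedInputsHeckeAtTwo

/-- (P3) THE RE-KEYED DECIDING THEOREM: live `closes` (rev 42) with `(hMTt) (hK1P)` replaced by `(hPubH) (hK1PH)`; body verbatim except the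
one application `hK1PH hG1 hG2 hG3 hG5 hGZK hPubH`. Same conclusion `Summit.BirchSwinnertonDyer.WAllNonCMAtTwoThetaHabitat`. -/
theorem closes_v3h (hmod : ModularParametrizationSupply)
    (hGZK : RankEqAnalyticRankLeOne) (hBF : BurungaleFlachCMRankZeroSupply)
    (hPer2 : RealPeriodPlusPeriodUnitAtTwoSupply) (hPubG : PublishedInputsGreenbergControlAtTwo)
    (hPubH : PublishedInputsHeckeAtTwo) (hK1PH : SignedTransportAtTwoRankZeroOfPubHecke)
    (hCMPf : SignedMainConjectureCMTwoRankZeroOfPubOfFlat) (hFlat : AnalyticMuFlatCMTwoRankZero)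
    (hKES : KatoEulerSystemBoundContraAtTwoSupply) (hKatoP : SignedKatoDivisibilityUpToAtTwoOfPub) (hStrP : SignedControlAtTwoOfPub) :
    Summit.BirchSwinnertonDyer.WAllNonCMAtTwoThetaHabitat := by
  -- displayed-inputs collapse (bsd-inputs-r2-p1 p609088, ROUTE-FREE module PublishedInputsOfNewform): 19273 EntireLFunctionRat
  -- BY NAME from the one modularity input 19266 (BCDT Thm A (6) ⇒ (2) + Hecke, Diamond–Shurman 5.10.2/8.8.3); hLrat leaves the binder list
  have hLrat : EntireLFunctionRat := Summit.BirchSwinnertonDyer.BirchSwinnertonDyer.Theorems.PublishedInputsOfNewform.entireLFunctionRat_of_modularParametrization hmod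
  -- K1 REPAIR (director W-75 WINDOW 5; tp2-p1 g8 verdict misstated, p600518 + p601303): K1 is asked only at the rank-0
  -- partner: K1Ar := hK1P at conjuncts 1,2,3,5 of hPubG, GZK and the Mazur–Tate congruence (top-level twin binder hMTt)
  -- K3R2(c′) (director W-73 (1) GO-ON-RETYPE; print-exact Kato 13.4(2)@2 fact p599770 in tree): K3 BY NAME from the
  -- PUB binder hKES (Kato's theorem, cite-level) and GZK via the twin K3P (research content = R2^ι, certificate p600818)
  have hKato : SignedKatoDivisibilityUpToAtTwo := hKatoP hKES hGZK
  -- PHASE T (reduced, T11r): K2r0 and K4 BY NAME from their published inputs (PUB binders) via the twins K2r0P / K4P; K3 (20308) stays a binder pending the K2 named-fact audit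
  obtain ⟨hG1, hG2, hG3, hG4, hG5⟩ := hPubG
  -- K2R0P♭ (director W-78 (c) GO-ON-FREEZE; lead tp2-p2 g8 FREEZE 06:49:03Z, K2r0PFlatCert v2 29fd7b4db6c99cf7): K2r0 BY NAME from
  -- the μ-free twin K2R0P♭ (PUB¹⁰ → FLAT → body; port-grade: PR04 Thm 7.3 at 2 via Kato 15.9) and the μ-input FLAT = (μ♭)_A
  -- (Perrin-Riou μ^± = 0 at p = 2 on the rank-0 CM members; open-problem grade class-wide, certificate-grade per class)
  have hCM : SignedMainConjectureCMTwoRankZero := hCMPf hBF hmod hLrat hGZK hPer2 hG1 hG2 hG3 hG4 hG5 hFlat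
  have hStr : SignedControlAtTwo := hStrP hG1 hG2 hG3 hG4 hG5
  intro W _ _ hcm hr hss ha hH
  obtain ⟨A, iA, iA', hAcm, hAr, hAss, hAa, hcong⟩ := hH
  have hL : W.entireLFunction 1 ≠ 0 := (W.analyticRank_eq_zero_iff_holds (hLrat W)).mp hr
  -- the CM partner's analytic data: newform, period ratio, a Pollack pair at 2 (needs L(A,1) ≠ 0)
  have hLA : A.entireLFunction 1 ≠ 0 := (A.analyticRank_eq_zero_iff_holds (hLrat A)).mp hAr
  haveI : NeZero (A.conductorNorm ℤ) := ⟨(A.conductorNorm_pos_holds).ne'⟩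
  obtain ⟨DmA⟩ := hmod A
  obtain ⟨ϖA, hϖApos, hϖAeq, hΩApos⟩ := DmA.exists_rat_mul_realPeriodRat_eq_plusPeriod
  obtain ⟨LsA, LfA, hSPA, hPPA⟩ :=
    Summit.BirchSwinnertonDyer.BirchSwinnertonDyer.Theorems.exists_isPollackPair_two DmA.isNewformOf hAss.1 hAa hLA
  -- K2r0 (rev 13): the CM partner's signed structure + main conjecture at 2, asked ONLY at analytic rank 0
  obtain ⟨hmuA, hMCA⟩ := hCM A hAcm hAr hAss hAa
  have hMC : Summit.BirchSwinnertonDyer.Rank1Residual.Supersingular.KobayashiMainConjecture W 2 1 :=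
    hK1PH hG1 hG2 hG3 hG5 hGZK hPubH W A hcm hr hss ha hAcm hAr hAss hAa hcong DmA.f DmA.isNewformOf ϖA hϖAeq LsA LfA hPPA hmuA hMCA
      (hKato W hcm hr hss ha)
  obtain ⟨h12, hKim⟩ := hStr W hcm hr hss ha
  exact Summit.BirchSwinnertonDyer.BirchSwinnertonDyer.Theorems.bsdp_two_of_kobayashiMainConjecture_two_of_frobeniusTrace_eq_zero
    W hmod hGZK hss.1 ha hL h12 hKim hMC

/-- (P2) THE RE-KEYED DECIDING THEOREM, twin variant: `(hMTt)` replaced by `(hPubH) (hMTtP : MazurTateCongruenceAtTwoTopOfPub)`, K1P kept;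
body verbatim except `hK1P hG1 hG2 hG3 hG5 hGZK (hMTtP hPubH)`. -/
theorem closes_v3t (hmod : ModularParametrizationSupply)
    (hGZK : RankEqAnalyticRankLeOne) (hBF : BurungaleFlachCMRankZeroSupply)
    (hPer2 : RealPeriodPlusPeriodUnitAtTwoSupply) (hPubG : PublishedInputsGreenbergControlAtTwo)
    (hPubH : PublishedInputsHeckeAtTwo) (hMTtP : MazurTateCongruenceAtTwoTopOfPub) (hK1P : SignedTransportAtTwoRankZeroOfPub)
    (hCMPf : SignedMainConjectureCMTwoRankZeroOfPubOfFlat) (hFlat : AnalyticMuFlatCMTwoRankZero)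
    (hKES : KatoEulerSystemBoundContraAtTwoSupply) (hKatoP : SignedKatoDivisibilityUpToAtTwoOfPub) (hStrP : SignedControlAtTwoOfPub) :
    Summit.BirchSwinnertonDyer.WAllNonCMAtTwoThetaHabitat := by
  -- displayed-inputs collapse (bsd-inputs-r2-p1 p609088, ROUTE-FREE module PublishedInputsOfNewform): 19273 EntireLFunctionRat
  -- BY NAME from the one modularity input 19266 (BCDT Thm A (6) ⇒ (2) + Hecke, Diamond–Shurman 5.10.2/8.8.3); hLrat leaves the binder list
  have hLrat : EntireLFunctionRat := Summit.BirchSwinnertonDyer.BirchSwinnertonDyer.Theorems.PublishedInputsOfNewform.entireLFunctionRat_of_modularParametrization hmod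
  -- K1 REPAIR (director W-75 WINDOW 5; tp2-p1 g8 verdict misstated, p600518 + p601303): K1 is asked only at the rank-0
  -- partner: K1Ar := hK1P at conjuncts 1,2,3,5 of hPubG, GZK and the Mazur–Tate congruence (top-level twin binder hMTt)
  -- K3R2(c′) (director W-73 (1) GO-ON-RETYPE; print-exact Kato 13.4(2)@2 fact p599770 in tree): K3 BY NAME from the
  -- PUB binder hKES (Kato's theorem, cite-level) and GZK via the twin K3P (research content = R2^ι, certificate p600818)
  have hKato : SignedKatoDivisibilityUpToAtTwo := hKatoP hKES hGZK
  -- PHASE T (reduced, T11r): K2r0 and K4 BY NAME from their published inputs (PUB binders) via the twins K2r0P / K4P; K3 (20308) stays a binder pending the K2 named-fact audit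
  obtain ⟨hG1, hG2, hG3, hG4, hG5⟩ := hPubG
  -- K2R0P♭ (director W-78 (c) GO-ON-FREEZE; lead tp2-p2 g8 FREEZE 06:49:03Z, K2r0PFlatCert v2 29fd7b4db6c99cf7): K2r0 BY NAME from
  -- the μ-free twin K2R0P♭ (PUB¹⁰ → FLAT → body; port-grade: PR04 Thm 7.3 at 2 via Kato 15.9) and the μ-input FLAT = (μ♭)_A
  -- (Perrin-Riou μ^± = 0 at p = 2 on the rank-0 CM members; open-problem grade class-wide, certificate-grade per class)
  have hCM : SignedMainConjectureCMTwoRankZero := hCMPf hBF hmod hLrat hGZK hPer2 hG1 hG2 hG3 hG4 hG5 hFlat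
  have hStr : SignedControlAtTwo := hStrP hG1 hG2 hG3 hG4 hG5
  intro W _ _ hcm hr hss ha hH
  obtain ⟨A, iA, iA', hAcm, hAr, hAss, hAa, hcong⟩ := hH
  have hL : W.entireLFunction 1 ≠ 0 := (W.analyticRank_eq_zero_iff_holds (hLrat W)).mp hr
  -- the CM partner's analytic data: newform, period ratio, a Pollack pair at 2 (needs L(A,1) ≠ 0)
  have hLA : A.entireLFunction 1 ≠ 0 := (A.analyticRank_eq_zero_iff_holds (hLrat A)).mp hAr
  haveI : NeZero (A.conductorNorm ℤ) := ⟨(A.conductorNorm_pos_holds).ne'⟩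
  obtain ⟨DmA⟩ := hmod A
  obtain ⟨ϖA, hϖApos, hϖAeq, hΩApos⟩ := DmA.exists_rat_mul_realPeriodRat_eq_plusPeriod
  obtain ⟨LsA, LfA, hSPA, hPPA⟩ :=
    Summit.BirchSwinnertonDyer.BirchSwinnertonDyer.Theorems.exists_isPollackPair_two DmA.isNewformOf hAss.1 hAa hLA
  -- K2r0 (rev 13): the CM partner's signed structure + main conjecture at 2, asked ONLY at analytic rank 0
  obtain ⟨hmuA, hMCA⟩ := hCM A hAcm hAr hAss hAa
  have hMC : Summit.BirchSwinnertonDyer.Rank1Residual.Supersingular.KobayashiMainConjecture W 2 1 :=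
    hK1P hG1 hG2 hG3 hG5 hGZK (hMTtP hPubH) W A hcm hr hss ha hAcm hAr hAss hAa hcong DmA.f DmA.isNewformOf ϖA hϖAeq LsA LfA hPPA hmuA hMCA
      (hKato W hcm hr hss ha)
  obtain ⟨h12, hKim⟩ := hStr W hcm hr hss ha
  exact Summit.BirchSwinnertonDyer.BirchSwinnertonDyer.Theorems.bsdp_two_of_kobayashiMainConjecture_two_of_frobeniusTrace_eq_zero
    W hmod hGZK hss.1 ha hL h12 hKim hMC

/-- SANITY: the live binder pair is recovered from the new one (so the present closes is an instance of `closes_v3h`'s hypotheses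
whenever 27435 is granted): nothing circular, nothing stronger is being assumed. -/
theorem k1P_and_mtt_give_k1PH (hMTt : MazurTateCongruenceAtTwoTop) (hK1P : SignedTransportAtTwoRankZeroOfPub) :
    SignedTransportAtTwoRankZeroOfPubHecke :=
  fun hG1 hG2 hG3 hG5 hGZK _ => hK1P hG1 hG2 hG3 hG5 hGZK hMTt

end Summit.BirchSwinnertonDyer.BirchSwinnertonDyer.Cruxes.MazurTateCongruenceAtTwoTop.CloseOut
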